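import Summits.NavierStokesRegularity.NavierStokesRegularity.Theorems.HubbleDynamoNoSelfExcitedDynamoStubFarFieldTransfer
import Summits.NavierStokesRegularity.NavierStokesRegularity.Theorems.HubbleDynamoNoSelfExcitedDynamoReduction
import Literature.Analysis.FluidPDE.KatoUniqueness
import HarnessLib

/-!
# Crux `NoSelfExcitedDynamo` (stmt-NavierStokesRegularity-1934), line `registered`:
# the FAR-FIELD RUNG in physical variables — the crux holds for every solution with one
# finite-energy slice (more generally, one slice with trivial blow-down at spatial infinity)

Theorems file (`--supports stmt-NavierStokesRegularity-1934`; theorems only, sorry-free).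

`NoSelfExcitedDynamo` asserts: every bounded ancient mild solution `u` of Navier–Stokes (`ν = 1`,
duality form) on `ℝ³ × (−∞, 0)` with measurable slices and the pointwise Type-I bound
`‖u(t, x)‖ ≤ C / (‖x‖ + √(−t))` has a.e.-zero slices (the KNSS Liouville conjecture in the pointwise
Type-I class; open). This file proves it for every such `u` ONE of whose slices `u(t₀)`, `t₀ < 0`,
has trivial blow-down at spatial infinity, `λ u(t₀)(λ ·) ⇀ 0` in `𝒟'` as `λ → +∞`
(`farFieldRung`), in particular for every such `u` with ONE slice of finite energy
(`farFieldRung_of_finiteEnergySlice`: the pointwise Type-I Liouville theorem HOLDS in the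
Leray–Hopf class). Equivalently (portrait of a counterexample): a pointwise-Type-I ancient solution
refuting the crux has infinite energy and a nontrivial `−1`-homogeneous (log-oscillating) tail at
spatial infinity at EVERY time.

## Proof

* `farFieldRung_slice_ae_eq` — every-slice identification: the continuous Oseen-mild representative
  `v` of `u` (`stub_oseenRepresentative`, equal to `u(t)` a.e. for a.e. `t`) agrees with `u(t)` a.e.
  for EVERY `t < 0`: both pairings `t ↦ ∫⟪u(t), φ⟫`, `t ↦ ∫⟪v(t), φ⟫` with divergence-free tests are
  continuous on `(−∞, 0)` (`IsBoundedAncientMildSolution.continuousOn_integral_inner`) and agree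
  a.e., hence everywhere; so `v(t) − u(t)` annihilates the divergence-free tests, is a.e. a constant
  (`IsWeaklyDivFree.exists_ae_eq_const_of_norm_le_of_forall_integral_inner_eq_zero`), and the constant
  is `0` by the decay `r‖·‖ ≤ 2C` (`eq_zero_of_ae_eq_const_of_cylRadius_mul_norm_le`).
* `farFieldRung` — the blow-down clause passes from `u(t₀)` to `v(t₀)` (change of variables
  `x ↦ λx`, `Measure.integral_comp_smul`, and `v(t₀) = u(t₀)` a.e.); `v` is classical with one
  pressure (`stub_classicalOfOseen`), Type-I (`reduction_hasTypeIDecay_of_ae_restrict`) and bounded,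
  so `farField_liouville_physical` (Albritton–Barker 2019, Thm 4.1, tree theorem) gives `v ≡ 0` for
  `t ≤ t₀`; the similarity profile `U = lerayOrbit v` is an eternal profile-class solution of
  Leray's backward system vanishing for `s ≤ −log(−t₀)`, so `stub_forwardVanishing` gives `U ≡ 0`,
  `v ≡ 0`, and `u(t) = v(t) = 0` a.e. for every `t < 0`.
* `farFieldRung_blowdown_of_sq_integrable` — a square-integrable slice has trivial blow-down:
  `|∫⟪λ g(λx), φ(x)⟫ dx| ≤ ½ λ^{-1/2} (‖g‖₂² + ‖φ‖₂²)` (weighted AM–GM and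
  `∫ |g(λx)|² dx = λ⁻³ ‖g‖₂²`).
-/

noncomputable section

-- the mandated stub namespace repeats `NavierStokesRegularity` (tree precedent for this crux's stubs)
set_option linter.dupNamespace false

namespace Summit.NavierStokesRegularity.NavierStokesRegularity.Theorems.NoSelfExcitedDynamo.Registered

open Set MeasureTheory Filter Topology InnerProductSpace Function Metric
open scoped RealInnerProductSpace NNReal ENNReal ContDiff
open Literature.Analysis Literature.Analysis.FluidPDE

/-! ### Every-slice identification of the continuous representative -/

/-- **Every-slice identification.** Let `u` be a bounded ancient mild solution (`ν = 1`, duality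
form) with measurable slices and pointwise Type-I decay, and let `v` be continuous on
`(−∞, 0) × ℝ³`, bounded, with weakly divergence-free slices, Oseen-mild, and equal to `u(t)` a.e. for
a.e. `t < 0` (the representative of `stub_oseenRepresentative`). Then `v(t) = u(t)` a.e. for EVERY
`t < 0`. -/
theorem farFieldRung_slice_ae_eq
    {u v : ℝ → EuclideanSpace ℝ (Fin 3) → EuclideanSpace ℝ (Fin 3)}
    (hu : IsBoundedAncientMildSolution 1 u) (hmeas : ∀ t < 0, AEStronglyMeasurable (u t) volume)
    {C : ℝ} (hC : HasTypeIDecay C u)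
    (hvc : ContinuousOn (uncurry v) (Iio 0 ×ˢ univ)) (hvb : ∃ M : ℝ, ∀ t < 0, ∀ x, ‖v t x‖ ≤ M)
    (hvdiv : ∀ t < 0, IsWeaklyDivFree (v t))
    (hvmild : ∀ s t : ℝ, s < t → t < 0 → ∀ x,
      v t x = UnboundedOperators.heatExtension (v s) (t - s) x - oseenDuhamel 1 s v v t x)
    (hvu : ∀ᵐ t ∂(volume.restrict (Iio (0 : ℝ))), v t =ᵐ[volume] u t) :
    ∀ t < 0, v t =ᵐ[volume] u t := by
  intro t₀ ht₀
  obtain ⟨Mu, hMu'⟩ := hu.2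
  have hMu : ∀ t < 0, ∀ x, ‖u t x‖ ≤ Mu := fun t ht x => hMu' t ht x
  obtain ⟨Mv, hMv⟩ := hvb
  -- `v` is itself a bounded ancient mild solution in the duality form
  have hmild' : ∀ s t : ℝ, s < t → t < 0 → ∀ x,
      v t x = UnboundedOperators.heatExtension (v s) (1 * (t - s)) x - oseenDuhamel 1 s v v t x := by
    intro s t hst ht x; rw [one_mul]; exact hvmild s t hst ht x
  have hv : IsBoundedAncientMildSolution 1 v :=
    isBoundedAncientMildSolution_of_oseen one_pos hvc ⟨Mv, hMv⟩ hvdiv hmild'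
  have hvslice : ∀ t < 0, Continuous (v t) := fun t ht =>
    hvc.comp_continuous (f := fun x : EuclideanSpace ℝ (Fin 3) => (t, x)) (by fun_prop)
      fun x => ⟨ht, mem_univ _⟩
  have hvmeas : ∀ t < 0, AEStronglyMeasurable (v t) volume := fun t ht =>
    (hvslice t ht).aestronglyMeasurable
  have hCv : HasTypeIDecay C v := reduction_hasTypeIDecay_of_ae_restrict hvc hvu hC
  -- the difference annihilates the divergence-free tests at `t₀`
  set w : EuclideanSpace ℝ (Fin 3) → EuclideanSpace ℝ (Fin 3) := v t₀ - u t₀ with hw_def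
  have hwmeas : AEStronglyMeasurable w volume := (hvmeas t₀ ht₀).sub (hmeas t₀ ht₀)
  have hwM : ∀ x, ‖w x‖ ≤ Mv + Mu := fun x =>
    (norm_sub_le _ _).trans (add_le_add (hMv t₀ ht₀ x) (hMu t₀ ht₀ x))
  have hwdiv : IsWeaklyDivFree w :=
    IsWeaklyDivFree.sub (p := ⊤) le_top (hvdiv t₀ ht₀) (hu.1.1 t₀ ht₀)
      (memLp_top_of_bound (hvmeas t₀ ht₀) Mv (Eventually.of_forall (hMv t₀ ht₀)))
      (memLp_top_of_bound (hmeas t₀ ht₀) Mu (Eventually.of_forall (hMu t₀ ht₀)))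
  have horth : ∀ φ : EuclideanSpace ℝ (Fin 3) → EuclideanSpace ℝ (Fin 3),
      FunctionSpaces.IsTestFunctionOn (⊤ : TopologicalSpace.Opens (EuclideanSpace ℝ (Fin 3))) φ →
      VectorCalculus.IsDivFree φ → ∫ x, ⟪w x, φ x⟫ = 0 := by
    intro φ hφ hdiv
    have hφi : Integrable φ := hφ.contDiff.continuous.integrable_of_hasCompactSupport hφ.hasCompactSupport
    have iu : Integrable fun x => ⟪u t₀ x, φ x⟫ :=
      integrable_inner_of_aestronglyMeasurable_of_norm_le (hmeas t₀ ht₀) (hMu t₀ ht₀) hφi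
    have iv : Integrable fun x => ⟪v t₀ x, φ x⟫ :=
      integrable_inner_of_aestronglyMeasurable_of_norm_le (hvmeas t₀ ht₀) (hMv t₀ ht₀) hφi
    -- the two continuous pairings agree a.e. on `(−∞, 0)`, hence at `t₀`
    have hF : ContinuousOn (fun t => ∫ x, ⟪u t x, φ x⟫) (Iio 0) :=
      hu.continuousOn_integral_inner one_pos hmeas hφ hdiv
    have hG : ContinuousOn (fun t => ∫ x, ⟪v t x, φ x⟫) (Iio 0) :=
      hv.continuousOn_integral_inner one_pos hvmeas hφ hdiv
    have hFG : (fun t => ∫ x, ⟪v t x, φ x⟫) =ᵐ[volume.restrict (Iio (0 : ℝ))]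
        fun t => ∫ x, ⟪u t x, φ x⟫ := by
      filter_upwards [hvu] with t ht
      exact integral_congr_ae (ht.mono fun x hx => by
        show ⟪v t x, φ x⟫ = ⟪u t x, φ x⟫
        rw [hx])
    have heq : (∫ x, ⟪v t₀ x, φ x⟫) = ∫ x, ⟪u t₀ x, φ x⟫ :=
      Measure.eqOn_open_of_ae_eq hFG isOpen_Iio hG hF ht₀
    have e : (fun x => ⟪w x, φ x⟫) = fun x => ⟪v t₀ x, φ x⟫ - ⟪u t₀ x, φ x⟫ := by
      funext x; rw [hw_def, Pi.sub_apply, inner_sub_left]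
    rw [e, integral_sub iv iu, heq, sub_self]
  obtain ⟨b, hb⟩ :=
    IsWeaklyDivFree.exists_ae_eq_const_of_norm_le_of_forall_integral_inner_eq_zero hwmeas hwM hwdiv horth
  -- the constant vanishes by the decay `r‖w‖ ≤ 2C`
  have hdecay : ∀ᵐ x ∂(volume : Measure (EuclideanSpace ℝ (Fin 3))), cylRadius x * ‖w x‖ ≤ C + C := by
    refine Eventually.of_forall fun x => ?_
    have h1 := reduction_cylRadius_mul_norm_le hCv t₀ ht₀ x
    have h2 := reduction_cylRadius_mul_norm_le hC t₀ ht₀ x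
    have hr : 0 ≤ cylRadius x := cylRadius_nonneg x
    calc cylRadius x * ‖w x‖ ≤ cylRadius x * (‖v t₀ x‖ + ‖u t₀ x‖) :=
          mul_le_mul_of_nonneg_left (norm_sub_le _ _) hr
      _ = cylRadius x * ‖v t₀ x‖ + cylRadius x * ‖u t₀ x‖ := by ring
      _ ≤ C + C := add_le_add h1 h2
  have hb0 : b = 0 := eq_zero_of_ae_eq_const_of_cylRadius_mul_norm_le hb hdecay
  rw [hb0] at hb
  filter_upwards [hb] with x hx
  have : v t₀ x - u t₀ x = 0 := hx
  exact sub_eq_zero.1 this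

/-! ### A square-integrable slice has trivial blow-down -/

/-- **Finite energy kills the blow-down**: if `g ∈ L²(ℝ³)` then `∫ ⟪λ g(λx), φ(x)⟫ dx → 0` as
`λ → +∞` for every test field `φ`: by the weighted AM–GM inequality
`λ|g(λx)||φ(x)| ≤ ½(θ|g(λx)|² + θ⁻¹λ²|φ(x)|²)` with `θ = λ²√λ` and the change of variables
`∫ |g(λx)|² dx = λ⁻³ ∫|g|²`, `|∫ ⟪λ g(λx), φ(x)⟫ dx| ≤ ½ λ^{-1/2} (‖g‖₂² + ‖φ‖₂²)`. -/
theorem farFieldRung_blowdown_of_sq_integrable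
    {g : EuclideanSpace ℝ (Fin 3) → EuclideanSpace ℝ (Fin 3)} (hg : MemLp g 2 volume)
    {φ : EuclideanSpace ℝ (Fin 3) → EuclideanSpace ℝ (Fin 3)}
    (hφ : FunctionSpaces.IsTestFunctionOn (⊤ : TopologicalSpace.Opens (EuclideanSpace ℝ (Fin 3))) φ) :
    Tendsto (fun lam : ℝ => ∫ x, ⟪lam • g (lam • x), φ x⟫) atTop (𝓝 0) := by
  have hφc : Continuous φ := hφ.contDiff.continuous
  have hφ2 : MemLp φ 2 volume := hφc.memLp_of_hasCompactSupport hφ.hasCompactSupport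
  have hgi : Integrable (fun x => ‖g x‖ ^ 2) := by
    have := hg.integrable_norm_rpow (by norm_num) (by norm_num)
    simpa using this
  have hφi : Integrable (fun x => ‖φ x‖ ^ 2) := by
    have := hφ2.integrable_norm_rpow (by norm_num) (by norm_num)
    simpa using this
  set A : ℝ := ∫ x, ‖g x‖ ^ 2 with hA
  set B : ℝ := ∫ x, ‖φ x‖ ^ 2 with hB
  -- the bound `|∫ ⟪λ g(λx), φ x⟫| ≤ (A + B) / (2 √λ)` for `λ > 0`
  have hbound : ∀ lam : ℝ, 0 < lam →
      ‖∫ x, ⟪lam • g (lam • x), φ x⟫‖ ≤ (A + B) / (2 * Real.sqrt lam) := by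
    intro lam hlam
    have hsq : 0 < Real.sqrt lam := Real.sqrt_pos.2 hlam
    set θ : ℝ := lam ^ 2 * Real.sqrt lam with hθ
    have hθ0 : 0 < θ := by positivity
    -- change of variables for the square of the rescaled slice
    have hcv : ∫ x, ‖g (lam • x)‖ ^ 2 = (lam ^ 3)⁻¹ * A := by
      have h := Measure.integral_comp_smul volume (fun y => ‖g y‖ ^ 2) lam
      rw [finrank_euclideanSpace_fin] at h
      rw [h, smul_eq_mul, abs_of_pos (inv_pos.2 (pow_pos hlam 3))]
    have hgli : Integrable (fun x => ‖g (lam • x)‖ ^ 2) := hgi.comp_smul hlam.ne'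
    -- the integrable majorant
    have hmaj : Integrable (fun x => θ / 2 * ‖g (lam • x)‖ ^ 2 + lam ^ 2 / (2 * θ) * ‖φ x‖ ^ 2) :=
      (hgli.const_mul _).add (hφi.const_mul _)
    have hpt : ∀ x, ‖⟪lam • g (lam • x), φ x⟫‖ ≤
        θ / 2 * ‖g (lam • x)‖ ^ 2 + lam ^ 2 / (2 * θ) * ‖φ x‖ ^ 2 := by
      intro x
      have h1 : ‖⟪lam • g (lam • x), φ x⟫‖ ≤ lam * ‖g (lam • x)‖ * ‖φ x‖ := by
        calc ‖⟪lam • g (lam • x), φ x⟫‖ ≤ ‖lam • g (lam • x)‖ * ‖φ x‖ := norm_inner_le_norm _ _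
          _ = lam * ‖g (lam • x)‖ * ‖φ x‖ := by rw [norm_smul, Real.norm_of_nonneg hlam.le]
      -- weighted AM–GM: `λ a b ≤ θ/2 a² + λ²/(2θ) b²`
      have h2 : lam * ‖g (lam • x)‖ * ‖φ x‖ ≤
          θ / 2 * ‖g (lam • x)‖ ^ 2 + lam ^ 2 / (2 * θ) * ‖φ x‖ ^ 2 := by
        set a := ‖g (lam • x)‖
        set b := ‖φ x‖
        have key : 0 ≤ (θ * a - lam * b) ^ 2 := sq_nonneg _
        have e : θ / 2 * a ^ 2 + lam ^ 2 / (2 * θ) * b ^ 2 - lam * a * b =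
            (θ * a - lam * b) ^ 2 / (2 * θ) := by
          field_simp
          ring
        have : 0 ≤ θ / 2 * a ^ 2 + lam ^ 2 / (2 * θ) * b ^ 2 - lam * a * b := by
          rw [e]; positivity
        linarith
      exact h1.trans h2
    calc ‖∫ x, ⟪lam • g (lam • x), φ x⟫‖
        ≤ ∫ x, θ / 2 * ‖g (lam • x)‖ ^ 2 + lam ^ 2 / (2 * θ) * ‖φ x‖ ^ 2 :=
          norm_integral_le_of_norm_le hmaj (Eventually.of_forall hpt)
      _ = θ / 2 * ((lam ^ 3)⁻¹ * A) + lam ^ 2 / (2 * θ) * B := by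
          rw [integral_add (hgli.const_mul _) (hφi.const_mul _), integral_const_mul, integral_const_mul,
            hcv]
      _ = (A + B) / (2 * Real.sqrt lam) := by
          have hl3 : lam ^ 3 = lam ^ 2 * (Real.sqrt lam * Real.sqrt lam) := by
            rw [Real.mul_self_sqrt hlam.le]; ring
          rw [hθ, hl3]
          field_simp
  -- `(A + B) / (2 √λ) → 0`
  have hlim : Tendsto (fun lam : ℝ => (A + B) / (2 * Real.sqrt lam)) atTop (𝓝 0) := by
    have h1 : Tendsto (fun lam : ℝ => 2 * Real.sqrt lam) atTop atTop :=
      (Real.tendsto_sqrt_atTop).const_mul_atTop (by norm_num)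
    have h3 : Tendsto (fun lam : ℝ => (A + B) * (2 * Real.sqrt lam)⁻¹) atTop (𝓝 ((A + B) * 0)) :=
      h1.inv_tendsto_atTop.const_mul (A + B)
    rw [mul_zero] at h3
    exact h3.congr fun lam => by rw [div_eq_mul_inv]
  refine squeeze_zero_norm' ?_ hlim
  filter_upwards [eventually_gt_atTop 0] with lam hlam
  exact hbound lam hlam

/-! ### The rung -/

/-- **The blow-down clause passes between a.e.-equal slices**: for `λ > 0`,
`∫ ⟪λ f(λx), φ x⟫ dx = ∫ ⟪λ g(λx), φ x⟫ dx` whenever `f = g` a.e. (change of variables `x ↦ λx`,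
`Measure.integral_comp_smul`). -/
theorem farFieldRung_integral_blowdown_congr
    {f g : EuclideanSpace ℝ (Fin 3) → EuclideanSpace ℝ (Fin 3)} (hfg : f =ᵐ[volume] g)
    (φ : EuclideanSpace ℝ (Fin 3) → EuclideanSpace ℝ (Fin 3)) {lam : ℝ} (hlam : 0 < lam) :
    ∫ x, ⟪lam • f (lam • x), φ x⟫ = ∫ x, ⟪lam • g (lam • x), φ x⟫ := by
  have key : ∀ h : EuclideanSpace ℝ (Fin 3) → EuclideanSpace ℝ (Fin 3),
      ∫ x, ⟪lam • h (lam • x), φ x⟫ =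
        |(lam ^ 3)⁻¹| • ∫ y, ⟪lam • h y, φ (lam⁻¹ • y)⟫ := by
    intro h
    have e := Measure.integral_comp_smul volume (fun y => ⟪lam • h y, φ (lam⁻¹ • y)⟫) lam
    rw [finrank_euclideanSpace_fin] at e
    rw [← e]
    refine integral_congr_ae (Eventually.of_forall fun x => ?_)
    simp only [inv_smul_smul₀ hlam.ne']
  rw [key f, key g]
  congr 1
  refine integral_congr_ae ?_
  filter_upwards [hfg] with y hy
  rw [hy]

/-- **The far-field rung of `NoSelfExcitedDynamo`.** Every bounded ancient mild solution `u` of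
Navier–Stokes (`ν = 1`, duality form) on `ℝ³ × (−∞, 0)` with measurable slices and the pointwise
Type-I bound `‖u(t, x)‖ ≤ C/(‖x‖ + √(−t))`, ONE of whose slices `u(t₀)`, `t₀ < 0`, has trivial
blow-down at spatial infinity — `∫ ⟪λ u(t₀)(λx), φ(x)⟫ dx → 0` as `λ → +∞` for every smooth
compactly supported field `φ` — has a.e.-zero slices. (Albritton–Barker 2019, Thm 4.1, tree theorem,
through `farField_liouville_physical`; the class supplies the weak-`L³` and heat-kernel clauses for
free, and forward vanishing is `stub_forwardVanishing` in similarity variables.) So a counterexample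
to the crux carries a nontrivial `−1`-homogeneous tail at spatial infinity at every time. -/
theorem farFieldRung :
    ∀ u : ℝ → EuclideanSpace ℝ (Fin 3) → EuclideanSpace ℝ (Fin 3),
      IsBoundedAncientMildSolution 1 u →
      (∀ t < 0, AEStronglyMeasurable (u t) volume) → (∃ C : ℝ, HasTypeIDecay C u) →
      (∃ t₀ : ℝ, t₀ < 0 ∧ ∀ φ : EuclideanSpace ℝ (Fin 3) → EuclideanSpace ℝ (Fin 3),
        FunctionSpaces.IsTestFunctionOn (⊤ : TopologicalSpace.Opens (EuclideanSpace ℝ (Fin 3))) φ →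
          Tendsto (fun lam : ℝ => ∫ x, ⟪lam • u t₀ (lam • x), φ x⟫) atTop (𝓝 0)) →
      ∀ t < 0, u t =ᵐ[volume] (0 : EuclideanSpace ℝ (Fin 3) → EuclideanSpace ℝ (Fin 3)) := by
  intro u hu hmeas hdec hzoom
  obtain ⟨C, hC⟩ := hdec
  obtain ⟨t₀, ht₀, hzoom⟩ := hzoom
  obtain ⟨v, hvc, hvb, hvdiv, hvmild, hvu⟩ := stub_oseenRepresentative u hu hmeas ⟨C, hC⟩
  have hid : ∀ t < 0, v t =ᵐ[volume] u t :=
    farFieldRung_slice_ae_eq hu hmeas hC hvc hvb hvdiv hvmild hvu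
  obtain ⟨p, hcl⟩ := stub_classicalOfOseen v hvc hvb hvdiv hvmild
  have hCv : HasTypeIDecay C v := reduction_hasTypeIDecay_of_ae_restrict hvc hvu hC
  have hbddv : IsBoundedOn (Iio 0) v := by
    obtain ⟨M, hM⟩ := hvb
    exact ⟨M, fun t ht x => hM t ht x⟩
  -- the blow-down clause for `v(t₀)`
  have hzoomv : ∀ φ : EuclideanSpace ℝ (Fin 3) → EuclideanSpace ℝ (Fin 3),
      FunctionSpaces.IsTestFunctionOn (⊤ : TopologicalSpace.Opens (EuclideanSpace ℝ (Fin 3))) φ →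
        Tendsto (fun lam : ℝ => ∫ x, ⟪lam • v t₀ (lam • x), φ x⟫) atTop (𝓝 0) := by
    intro φ hφ
    refine (hzoom φ hφ).congr' ?_
    filter_upwards [eventually_gt_atTop 0] with lam hlam
    exact farFieldRung_integral_blowdown_congr (hid t₀ ht₀).symm φ hlam
  -- Albritton–Barker: `v ≡ 0` up to `t₀`
  have hvan : ∀ t ≤ t₀, ∀ x, v t x = 0 := farField_liouville_physical hcl hCv hbddv ht₀ hzoomv
  -- the similarity profile is an eternal profile-class solution vanishing on a past half-line
  have hL : IsBackwardLeraySolutionOn univ 1 (lerayOrbit v) (lerayOrbitPressure p) :=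
    isClassicalNSSolutionOn_Iio_iff_isBackwardLeraySolutionOn.1 hcl
  have hsmooth : ∀ t < 0, ContDiff ℝ ∞ (v t) := fun t ht => hcl.contDiff_velocity ht
  have hder := stub_derivativeDecay v p C hcl hCv
  have hprof : ∀ k : ℕ, ∃ K : ℝ, ∀ s y,
      (1 + ‖y‖) ^ (k + 1) * ‖iteratedFDeriv ℝ k (lerayOrbit v s) y‖ ≤ K := by
    intro k
    obtain ⟨C', hC'⟩ := hder k
    exact ⟨C', reduction_profileBound v k
      (fun t ht => (hsmooth t ht).of_le (by exact_mod_cast le_top)) hC'⟩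
  set s₀ : ℝ := -Real.log (-t₀) with hs₀
  have hpast : ∀ s ≤ s₀, ∀ y, lerayOrbit v s y = 0 := by
    intro s hs y
    have ht : -Real.exp (-s) ≤ t₀ := by
      have h1 : Real.log (-t₀) ≤ -s := by rw [hs₀] at hs; linarith
      have h2 : -t₀ ≤ Real.exp (-s) := by
        calc -t₀ = Real.exp (Real.log (-t₀)) := (Real.exp_log (neg_pos.2 ht₀)).symm
          _ ≤ Real.exp (-s) := Real.exp_le_exp.2 h1
      linarith
    rw [lerayOrbit_apply, hvan _ ht, smul_zero]
  have hzero : ∀ s y, lerayOrbit v s y = 0 := stub_forwardVanishing _ _ hL hprof s₀ hpast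
  -- back to `v`, then to `u`
  have hvt : ∀ t < 0, ∀ x, v t x = 0 := by
    intro t ht x
    rw [eq_lerayOrbit_of_neg v ht x, hzero, smul_zero]
  intro t ht
  filter_upwards [hid t ht] with x hx
  rw [← hx, hvt t ht x]
  rfl

/-- **The finite-energy rung of `NoSelfExcitedDynamo`** (the pointwise Type-I Liouville theorem
holds in the Leray–Hopf class). Every bounded ancient mild solution `u` of Navier–Stokes (`ν = 1`,
duality form) on `ℝ³ × (−∞, 0)` with measurable slices, the pointwise Type-I bound
`‖u(t, x)‖ ≤ C/(‖x‖ + √(−t))`, and ONE slice of finite kinetic energy, `u(t₀) ∈ L²(ℝ³)` for some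
`t₀ < 0`, has a.e.-zero slices (`farFieldRung` + `farFieldRung_blowdown_of_sq_integrable`).
Contrapositive (portrait): a counterexample to the crux has infinite energy at every time. -/
theorem farFieldRung_of_finiteEnergySlice :
    ∀ u : ℝ → EuclideanSpace ℝ (Fin 3) → EuclideanSpace ℝ (Fin 3),
      IsBoundedAncientMildSolution 1 u →
      (∀ t < 0, AEStronglyMeasurable (u t) volume) → (∃ C : ℝ, HasTypeIDecay C u) →
      (∃ t₀ : ℝ, t₀ < 0 ∧ MemLp (u t₀) 2 volume) →
      ∀ t < 0, u t =ᵐ[volume] (0 : EuclideanSpace ℝ (Fin 3) → EuclideanSpace ℝ (Fin 3)) := by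
  intro u hu hmeas hdec hL2
  obtain ⟨t₀, ht₀, hg⟩ := hL2
  exact farFieldRung u hu hmeas hdec
    ⟨t₀, ht₀, fun φ hφ => farFieldRung_blowdown_of_sq_integrable hg hφ⟩

end Summit.NavierStokesRegularity.NavierStokesRegularity.Theorems.NoSelfExcitedDynamo.Registered

end
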